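import Summits.QuantumFields.YangMills.Theorems.FluctuationComparisonRegPrIntLS2BetaCriticalOrbitUniqueOfExab
import Summits.QuantumFields.YangMills.Theorems.FluctuationComparisonRegPrIntLS2BetaAbelianCriticalOfMinFree
import HarnessLib

/-!
# S2β · [Balaban1985Variational] Prop. 7 clause 1 at every `2`-small datum, `L ≥ 5`, MODULO EX^{ab}′ — the lettering-free editions of ✓FILE 3 ∕ ✓FILE 4's doors

Cell `ym3-torus` (YM ladder rung R3 = continuum `SU(2)` Yang–Mills on the three-torus at fixed lattice data — a RUNG: NOT d = 4, NOT infinite volume,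
NOT a mass gap, NOT Clay).  Width seat `ym3-torus-px12` (gen 21), pen (B) «ABELIAN STRATUM» FILE 6; crux `stmt-QuantumFields-20520`
(`…Theses.UnitScaleTilt.FluctuationComparisonRegPrIntL`), LINE S2β; `--kind proof --supports stmt-QuantumFields-20520 --as helper`: count-neutral, DEFINITION-FREE
(0 `def`, 0 `instance`, 0 `notation`, 0 `sorry`, default heartbeats).

WHY.  ✓FILE 3 (`…S2BetaCriticalOrbitUniqueAbelian`) and ✓FILE 4 (`…S2BetaCriticalOrbitUniqueOfExab`) deliver Prop. 7 clause 1 (`AtMostOneCriticalOrbit e V`) and pen 4's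
`hlift` token modulo the abelian letter EX^{ab}, which carried a LETTERING `a` of the diagonal minimiser `W = e^{a·iσ₃}` and strict loop-sum guards at every averaging
level — kinematic dressing forced by reading the (0.4) average through one global lettering.  ✓FILE 5 (`…S2BetaAbelianCriticalOfMinFree`) removed the dressing from the
E–L supplier (`el_of_abelianMin_free`: the averaging of record is multiplicative on σ₃-diagonal fields inside its guard).  This file re-issues the three doors of FILE 3 and the
master door of FILE 4 with the letter shrunk accordingly.

THE ONE DISPLAYED LETTER (desk №303∕№312; names fixed for the funnel).
  EX^{ab}′(V′) := «∃ W : GaugeField (F.P K) 0 SU(2), (∀ b, Commute ↑(W b) σ₃) ∧ W ∈ regFibrePr F n K e V′ ∧ ∀ W′, (∀ b, Commute ↑(W′ b) σ₃) → W′ ∈ regFibrePr F n K e V′ →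
               A(W) ≤ A(W′)»  — an abelian constrained minimiser of the Wilson action over the σ₃-DIAGONAL members of print's open regular fibre (6)(e) over `V′`, asked only at
  the σ₃-diagonal case-A representatives `V′ = g • V`.  EX^{ab}′ ⟸ {✓`diagonalLift_abelian` (a σ₃-diagonal regular member exists over a small diagonal datum), compactness of the
  closed diagonal fibre, REG^{ab}}, where REG^{ab} := «a minimiser of A over the CLOSED σ₃-diagonal (6)(e)-fibre is strictly (6)(e)-regular» (the sup-norm regularity of the
  constrained abelian minimiser, [Balaban1985Variational] Prop. 7 p.299 with propagator decay).  REG^{ab} is NOT claimed, NOT proved, and NOT a hypothesis of any theorem here.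

WHAT (`SU(2)`, every `L ≥ 5`; all hypothesis-form, the hypotheses being EX^{ab}′'s three conjuncts `hW`, `hreg`, `hmin`).
* ★★★`atMostOneCriticalOrbit_of_abelianMinFree_five` — Prop. 7 cl. 1 over a datum with constant-diagonal stabiliser, from a σ₃-diagonal constrained minimiser `W` (no lettering,
  no guards, no side-length row `K − n ≤ m + K_P`: compare ✓FILE 3 `atMostOneCriticalOrbit_of_abelianMin_five`).
* ★★★`symmetriesLift_at_critical_of_abelianMinFree_five` — pen 4's `hlift` token at EVERY R2-critical `U₀ ∈ regFibrePr F n K e V` over such a datum.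
* ★★★`atMostOneCriticalOrbit_of_abelianMinFree_caseA_five` — the same at a case-A diagonal datum.
* ★★★★`atMostOneCriticalOrbit_five_of_exabFree` — THE MASTER DOOR: Prop. 7 clause 1 at EVERY `2`-small datum, `L ≥ 5`, modulo EX^{ab}′ at the diagonal case-A representatives
  (irreducible stratum ✓px21, case B ✓FILE 4 unconditional, transport ✓`atMostOneCriticalOrbit_gaugeAct`).

HONEST.  Bookkeeping over ✓FILE 3∕4∕5 and ✓pen 7; EX^{ab}′ stays a HYPOTHESIS; REG^{ab} NOT claimed; nothing of Bałaban's analysis asserted; (E), ISOL∘, TUBE-REG∘, GAP♯∘, EXW∘,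
S2β and crux 20520 NOT proved; rung R3 = `YM3TorusSU2` as filed — SU(2) YM₃ on T³; the Yang–Mills mass gap is NOT proved.  Sorry-free, axioms standard.
[cite: Balaban1985Variational, Prop. 7 p.299, (2)-(7) p.278, (141)-(143) p.299; Balaban1985BackgroundPropagators, (3.21) p.394; Balaban1985Averaging, (8)-(13) p.19, (52)-(54) p.26]
-/

set_option autoImplicit false

noncomputable section

open scoped Matrix.Norms.L2Operator
open Literature.MathematicalPhysics.QuantumFieldTheory.Balaban1983to89
open Literature.MathematicalPhysics.QuantumFieldTheory.Balaban1983to89.T4Continuum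
open Literature.MathematicalPhysics.QuantumFieldTheory.Balaban1983to89.ExpMeanLog (deltaSU)
open Literature.MathematicalPhysics.QuantumFieldTheory.Balaban1983to89.B9AdOrthogonal (σ₃)
open Literature.MathematicalPhysics.QuantumFieldTheory.Balaban1983to89.B10Eq27TorusAxialLog (unitsField toUField)
open Literature.MathematicalPhysics.QuantumFieldTheory.Balaban1983to89.T3ContinuumYM3Torus
open Literature.MathematicalPhysics.QuantumFieldTheory.Balaban1983to89.T3UnitLawDensityEML (ℰp)
open Literature.MathematicalPhysics.QuantumFieldTheory.Balaban1983to89.T3ConstrainedMinimiser (fibre)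
open Literature.MathematicalPhysics.QuantumFieldTheory.Balaban1983to89.T3PrintedRegularMinimiser
open Literature.MathematicalPhysics.QuantumFieldTheory.Balaban1983to89.T3PrintedRegularOrbits (descTransf liftTransfTo descTransf_liftTransfTo plaqSmall_gaugeAct_iff')
open Literature.MathematicalPhysics.QuantumFieldTheory.Balaban1983to89.T3Thm1Carrier (varProblem3)
open Literature.MathematicalPhysics.QuantumFieldTheory.Balaban1983to89.T3Thm1CarrierNative (IsCritR2)
open Summit.QuantumFields.YangMills.Theorems.Prop7NestedMeanParallelLiftDiagGauge (parallelConstDiag_or_loopHol_central onlyScalar_or_exists_gauge_commute_sigma3)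
open Summit.QuantumFields.YangMills.Theorems.Prop7OrbitTransport (atMostOneCriticalOrbit_gaugeAct)
open Summit.QuantumFields.YangMills.Theorems.Prop7CritEL (deriv_comp_eq_zero_of_isCritR2 continuousAt_of_differentiableAt_bonds)
open Summit.QuantumFields.YangMills.Theorems.FluctuationComparisonRegPrIntLS2BetaCriticalELRelated
  (atMostOneCriticalOrbit_of_el_symmetriesLift_five critical_gaugeRelated_of_el_five symmetriesLift_gaugeAct)
open Summit.QuantumFields.YangMills.Theorems.FluctuationComparisonRegPrIntLS2BetaCentralStabOfIrr (atMostOneCriticalOrbit_of_irr_five)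
open Summit.QuantumFields.YangMills.Theorems.FluctuationComparisonRegPrIntLS2BetaCriticalOrbitUniqueAbelian (symmetriesLift_of_diagonal stab_const_of_parallelConstDiag)
open Summit.QuantumFields.YangMills.Theorems.FluctuationComparisonRegPrIntLS2BetaCriticalOrbitUniqueOfExab (atMostOneCriticalOrbit_of_loopHol_central irr_of_onlyScalar)
open Summit.QuantumFields.YangMills.Theorems.FluctuationComparisonRegPrIntLS2BetaAbelianCriticalOfMinFree (el_of_abelianMin_free)

namespace Summit.QuantumFields.YangMills.Theorems.FluctuationComparisonRegPrIntLS2BetaCriticalOrbitUniqueOfExabFree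

/-! ## §1 Prop. 7 clause 1 and the lift property at the abelian datum, modulo EX^{ab}′ -/

section Abelian

/-- ★★★ **[Balaban1985Variational] PROP. 7 CLAUSE 1 AT THE ABELIAN STRATUM, MODULO EX^{ab}′, EVERY `L ≥ 5`.**  There is `e₉ > 0` such that for every member `F` with
`F.L = L`, heights `n < K`, every `0 < e ≤ e₉` with the admissibility rows `143·(49∕4)²·e ≤ 1∕3`, `2e ≤ 2δ₂∕(7L)²`, every datum `V` whose stabiliser consists of constant
σ₃-diagonal gauge transformations (`hStab`), and every σ₃-DIAGONAL `W ∈ regFibrePr F n K e V` minimising the Wilson action among the σ₃-diagonal members of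
`regFibrePr F n K e V` (EX^{ab}′ — the hypotheses `hW`, `hreg`, `hmin`): ANY TWO R2-CRITICAL points of (6)(e) over `V` lie on one orbit of print's group (4).
Proof: ✓pen 7 `atMostOneCriticalOrbit_of_el_symmetriesLift_five` at `W`, E–L letter by ✓FILE 5 `el_of_abelianMin_free`, lift letter by ✓FILE 3 `symmetriesLift_of_diagonal`.
[cite: Balaban1985Variational, Prop. 7 p.299, (2)-(6) p.278, (141)-(143) p.299; Balaban1985RegularSpaces, Thm 2 p.83; Balaban1985Averaging, (52)-(54) p.26] -/
theorem atMostOneCriticalOrbit_of_abelianMinFree_five (L : ℕ) (h5 : 5 ≤ L) :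
    ∃ e₉ : ℝ, 0 < e₉ ∧ ∀ (F : T3Family), F.L = L → ∀ (n K : ℕ) (hnK : n < K)
      (e : ℝ) (V : GaugeField (F.P n) 0 (Matrix.specialUnitaryGroup (Fin 2) ℂ)) (W : GaugeField (F.P K) 0 (Matrix.specialUnitaryGroup (Fin 2) ℂ)),
      0 < e → e ≤ e₉ → (143 * ((((3 + 4 : ℕ) : ℝ)) ^ 2 / 4) ^ 2) * e ≤ 1 / 3 → 2 * e ≤ 2 * deltaSU (Fin 2) / (((3 + 4) * F.L : ℕ) : ℝ) ^ 2 →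
      (∀ s : GaugeTransf (F.P n) 0 (Matrix.specialUnitaryGroup (Fin 2) ℂ), GaugeField.gaugeAct s V = V →
        ∃ c : Matrix.specialUnitaryGroup (Fin 2) ℂ, Commute ((c : Matrix.specialUnitaryGroup (Fin 2) ℂ) : Matrix (Fin 2) (Fin 2) ℂ) σ₃ ∧ s = fun _ => c) →
      (∀ b, Commute ((W b : Matrix.specialUnitaryGroup (Fin 2) ℂ) : Matrix (Fin 2) (Fin 2) ℂ) σ₃) →
      W ∈ regFibrePr F n K hnK.le e V →
      (∀ W' : GaugeField (F.P K) 0 (Matrix.specialUnitaryGroup (Fin 2) ℂ),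
        (∀ b, Commute ((W' b : Matrix.specialUnitaryGroup (Fin 2) ℂ) : Matrix (Fin 2) (Fin 2) ℂ) σ₃) → W' ∈ regFibrePr F n K hnK.le e V →
          wilsonAction4 W ≤ wilsonAction4 W') →
      (varProblem3 F n K hnK.le).AtMostOneCriticalOrbit e V := by
  obtain ⟨e₈, he₈, H⟩ := atMostOneCriticalOrbit_of_el_symmetriesLift_five L h5
  refine ⟨e₈, he₈, ?_⟩
  intro F hF n K hnK e V W he hee hr3 hr2 hStab hW hreg hmin
  exact H F hF n K hnK e V he hee ⟨W, hreg, el_of_abelianMin_free F hnK.le he hr3 hr2 hW hreg hmin, symmetriesLift_of_diagonal F hnK.le hW hStab⟩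

/-- ★★★ **THE LIFT PROPERTY AT EVERY R2-CRITICAL POINT OVER AN ABELIAN DATUM, MODULO EX^{ab}′** — the `hlift` token of pen 4 ∕ (T7-red) at the organ's base point `U₀`:
under the hypotheses of `atMostOneCriticalOrbit_of_abelianMinFree_five`, every R2-critical `U₀ ∈ regFibrePr F n K e V` is `u • W` with `(u↓) • V = V` (✓pen 7
`critical_gaugeRelated_of_el_five`), and the lift property of the diagonal `W` transports along `u` (✓pen 7 `symmetriesLift_gaugeAct`).
[cite: Balaban1985Variational, (4)-(6) p.278, Prop. 7 p.299, (141)-(143) p.299; Balaban1985Averaging, (11)-(13) p.19] -/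
theorem symmetriesLift_at_critical_of_abelianMinFree_five (L : ℕ) (h5 : 5 ≤ L) :
    ∃ e₉ : ℝ, 0 < e₉ ∧ ∀ (F : T3Family), F.L = L → ∀ (n K : ℕ) (hnK : n < K)
      (e : ℝ) (V : GaugeField (F.P n) 0 (Matrix.specialUnitaryGroup (Fin 2) ℂ)) (W : GaugeField (F.P K) 0 (Matrix.specialUnitaryGroup (Fin 2) ℂ)),
      0 < e → e ≤ e₉ → (143 * ((((3 + 4 : ℕ) : ℝ)) ^ 2 / 4) ^ 2) * e ≤ 1 / 3 → 2 * e ≤ 2 * deltaSU (Fin 2) / (((3 + 4) * F.L : ℕ) : ℝ) ^ 2 →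
      (∀ s : GaugeTransf (F.P n) 0 (Matrix.specialUnitaryGroup (Fin 2) ℂ), GaugeField.gaugeAct s V = V →
        ∃ c : Matrix.specialUnitaryGroup (Fin 2) ℂ, Commute ((c : Matrix.specialUnitaryGroup (Fin 2) ℂ) : Matrix (Fin 2) (Fin 2) ℂ) σ₃ ∧ s = fun _ => c) →
      (∀ b, Commute ((W b : Matrix.specialUnitaryGroup (Fin 2) ℂ) : Matrix (Fin 2) (Fin 2) ℂ) σ₃) →
      W ∈ regFibrePr F n K hnK.le e V →
      (∀ W' : GaugeField (F.P K) 0 (Matrix.specialUnitaryGroup (Fin 2) ℂ),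
        (∀ b, Commute ((W' b : Matrix.specialUnitaryGroup (Fin 2) ℂ) : Matrix (Fin 2) (Fin 2) ℂ) σ₃) → W' ∈ regFibrePr F n K hnK.le e V →
          wilsonAction4 W ≤ wilsonAction4 W') →
      ∀ U₀ : GaugeField (F.P K) 0 (Matrix.specialUnitaryGroup (Fin 2) ℂ), U₀ ∈ regFibrePr F n K hnK.le e V → IsCritR2 F n K hnK.le V U₀ →
        ∀ s : GaugeTransf (F.P n) 0 (Matrix.specialUnitaryGroup (Fin 2) ℂ), GaugeField.gaugeAct s V = V →
          ∃ k : GaugeTransf (F.P K) 0 (Matrix.specialUnitaryGroup (Fin 2) ℂ), GaugeField.gaugeAct k U₀ = U₀ ∧ descTransf F n K hnK.le k = s := by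
  obtain ⟨e₈, he₈, H⟩ := critical_gaugeRelated_of_el_five L h5
  refine ⟨e₈, he₈, ?_⟩
  intro F hF n K hnK e V W he hee hr3 hr2 hStab hW hreg hmin U₀ hU₀ hcrit
  have hELW := el_of_abelianMin_free F hnK.le he hr3 hr2 hW hreg hmin
  have hELU : ∀ γ : ℝ → GaugeField (F.P K) 0 (Matrix.specialUnitaryGroup (Fin 2) ℂ), γ 0 = U₀ → (∀ t, γ t ∈ fibre F ℰp n K hnK.le V) →
      (∀ b, DifferentiableAt ℝ (fun t => ((γ t b : Matrix.specialUnitaryGroup (Fin 2) ℂ) : Matrix (Fin 2) (Fin 2) ℂ)) 0) →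
        deriv (fun t => wilsonAction4 (γ t)) 0 = 0 :=
    fun γ hγ0 hγfib hγd => deriv_comp_eq_zero_of_isCritR2 hcrit γ hγ0 hγfib (continuousAt_of_differentiableAt_bonds γ hγd)
  obtain ⟨u, rfl, hfix⟩ := H F hF n K hnK e V _ U₀ he hee hreg hELW hU₀ hELU
  exact symmetriesLift_gaugeAct F hnK.le u hfix (symmetriesLift_of_diagonal F hnK.le hW hStab)

/-- ★★★ **THE SAME AT A CASE-A DIAGONAL DATUM** (✓`parallelConstDiag_or_loopHol_central`'s first disjunct in place of `hStab`): Prop. 7 clause 1 over every coarse `V` all of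
whose `V♭`-parallel matrix sections are constants commuting with `σ₃`, modulo EX^{ab}′. [cite: Balaban1985Variational, Prop. 7 p.299; Balaban1985BackgroundPropagators, (3.21) p.394] -/
theorem atMostOneCriticalOrbit_of_abelianMinFree_caseA_five (L : ℕ) (h5 : 5 ≤ L) :
    ∃ e₉ : ℝ, 0 < e₉ ∧ ∀ (F : T3Family), F.L = L → ∀ (n K : ℕ) (hnK : n < K)
      (e : ℝ) (V : GaugeField (F.P n) 0 (Matrix.specialUnitaryGroup (Fin 2) ℂ)) (W : GaugeField (F.P K) 0 (Matrix.specialUnitaryGroup (Fin 2) ℂ)),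
      0 < e → e ≤ e₉ → (143 * ((((3 + 4 : ℕ) : ℝ)) ^ 2 / 4) ^ 2) * e ≤ 1 / 3 → 2 * e ≤ 2 * deltaSU (Fin 2) / (((3 + 4) * F.L : ℕ) : ℝ) ^ 2 →
      (∀ c : Site (F.P n) 0 → Matrix (Fin 2) (Fin 2) ℂ,
        (∀ e' : PBond (F.P n) 0, c e'.src = ((unitsField (toUField V) e' : (Matrix (Fin 2) (Fin 2) ℂ)ˣ) : Matrix (Fin 2) (Fin 2) ℂ) * c e'.tgt *
          (((unitsField (toUField V) e')⁻¹ : (Matrix (Fin 2) (Fin 2) ℂ)ˣ) : Matrix (Fin 2) (Fin 2) ℂ)) →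
        ∃ c₀ : Matrix (Fin 2) (Fin 2) ℂ, (∀ y, c y = c₀) ∧ Commute c₀ σ₃) →
      (∀ b, Commute ((W b : Matrix.specialUnitaryGroup (Fin 2) ℂ) : Matrix (Fin 2) (Fin 2) ℂ) σ₃) →
      W ∈ regFibrePr F n K hnK.le e V →
      (∀ W' : GaugeField (F.P K) 0 (Matrix.specialUnitaryGroup (Fin 2) ℂ),
        (∀ b, Commute ((W' b : Matrix.specialUnitaryGroup (Fin 2) ℂ) : Matrix (Fin 2) (Fin 2) ℂ) σ₃) → W' ∈ regFibrePr F n K hnK.le e V →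
          wilsonAction4 W ≤ wilsonAction4 W') →
      (varProblem3 F n K hnK.le).AtMostOneCriticalOrbit e V := by
  obtain ⟨e₉, he₉, H⟩ := atMostOneCriticalOrbit_of_abelianMinFree_five L h5
  exact ⟨e₉, he₉, fun F hF n K hnK e V W he hee hr3 hr2 hA => H F hF n K hnK e V W he hee hr3 hr2 (stab_const_of_parallelConstDiag F hA)⟩

end Abelian

/-! ## §2 The master door: Prop. 7 clause 1 at every datum, modulo EX^{ab}′ at the diagonal representative -/

section Master

/-- ★★★★ **[Balaban1985Variational] PROP. 7 CLAUSE 1 AT EVERY `2`-SMALL DATUM, `L ≥ 5`, MODULO EX^{ab}′.**  There is `e₉ > 0` such that for every member `F` (`F.L = L`),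
heights `n < K`, every `0 < e ≤ e₉` with the admissibility rows `143·(49∕4)²·e ≤ 1∕3`, `2e ≤ 2δ₂∕(7L)²`, and every datum `V` with `PlaqSmall δ V`, `δ ≤ 2`: IF, for
every coarse gauge `g` such that `g • V` is σ₃-diagonal of case A (all `(g • V)♭`-parallel matrix sections constant diagonal), an ABELIAN CONSTRAINED MINIMISER over
`g • V` is supplied — a σ₃-DIAGONAL `W ∈ regFibrePr F n K e (g • V)` minimising the Wilson action among the σ₃-diagonal members of `regFibrePr F n K e (g • V)` (EX^{ab}′, the
ONLY letter; NO lettering, NO loop-sum guards) —, THEN `(varProblem3 F n K hnK.le).AtMostOneCriticalOrbit e V`: any two R2-critical configurations of (6)(e) over `V` lie on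
one orbit of print's group (4).  Strata: irreducible (✓px21 `atMostOneCriticalOrbit_of_irr_five` ∘ ✓FILE 4 `irr_of_onlyScalar`), diagonalisable
(✓`onlyScalar_or_exists_gauge_commute_sigma3`) of case B (✓FILE 4 `atMostOneCriticalOrbit_of_loopHol_central`, unconditional) or case A (§1 ⟸ EX^{ab}′); the clause moves
along the diagonalising gauge by ✓`atMostOneCriticalOrbit_gaugeAct`. [cite: Balaban1985Variational, Prop. 7 p.299, (2)-(7) p.278; Balaban1985BackgroundPropagators, (3.21) p.394; Balaban1985Averaging, (8)-(13) p.19] -/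
theorem atMostOneCriticalOrbit_five_of_exabFree (L : ℕ) (h5 : 5 ≤ L) :
    ∃ e₉ : ℝ, 0 < e₉ ∧ ∀ (F : T3Family), F.L = L → ∀ (n K : ℕ) (hnK : n < K) (e : ℝ) (V : GaugeField (F.P n) 0 (Matrix.specialUnitaryGroup (Fin 2) ℂ)) (δ : ℝ),
      0 < e → e ≤ e₉ → (143 * ((((3 + 4 : ℕ) : ℝ)) ^ 2 / 4) ^ 2) * e ≤ 1 / 3 → 2 * e ≤ 2 * deltaSU (Fin 2) / (((3 + 4) * F.L : ℕ) : ℝ) ^ 2 →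
      δ ≤ 2 → PlaqSmall δ V →
      (∀ g : GaugeTransf (F.P n) 0 (Matrix.specialUnitaryGroup (Fin 2) ℂ),
        (∀ e' : PBond (F.P n) 0, Commute ((GaugeField.gaugeAct g V e' : Matrix.specialUnitaryGroup (Fin 2) ℂ) : Matrix (Fin 2) (Fin 2) ℂ) σ₃) →
        (∀ c : Site (F.P n) 0 → Matrix (Fin 2) (Fin 2) ℂ,
          (∀ e' : PBond (F.P n) 0, c e'.src = ((unitsField (toUField (GaugeField.gaugeAct g V)) e' : (Matrix (Fin 2) (Fin 2) ℂ)ˣ) : Matrix (Fin 2) (Fin 2) ℂ) * c e'.tgt *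
            (((unitsField (toUField (GaugeField.gaugeAct g V)) e')⁻¹ : (Matrix (Fin 2) (Fin 2) ℂ)ˣ) : Matrix (Fin 2) (Fin 2) ℂ)) →
          ∃ c₀ : Matrix (Fin 2) (Fin 2) ℂ, (∀ y, c y = c₀) ∧ Commute c₀ σ₃) →
        ∃ W : GaugeField (F.P K) 0 (Matrix.specialUnitaryGroup (Fin 2) ℂ),
          (∀ b, Commute ((W b : Matrix.specialUnitaryGroup (Fin 2) ℂ) : Matrix (Fin 2) (Fin 2) ℂ) σ₃) ∧
          W ∈ regFibrePr F n K hnK.le e (GaugeField.gaugeAct g V) ∧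
          ∀ W' : GaugeField (F.P K) 0 (Matrix.specialUnitaryGroup (Fin 2) ℂ),
            (∀ b, Commute ((W' b : Matrix.specialUnitaryGroup (Fin 2) ℂ) : Matrix (Fin 2) (Fin 2) ℂ) σ₃) → W' ∈ regFibrePr F n K hnK.le e (GaugeField.gaugeAct g V) →
              wilsonAction4 W ≤ wilsonAction4 W') →
      (varProblem3 F n K hnK.le).AtMostOneCriticalOrbit e V := by
  obtain ⟨e₈, he₈, HI⟩ := atMostOneCriticalOrbit_of_irr_five L h5
  obtain ⟨e₉, he₉, HA⟩ := atMostOneCriticalOrbit_of_abelianMinFree_caseA_five L h5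
  refine ⟨min e₈ e₉, lt_min he₈ he₉, ?_⟩
  intro F hF n K hnK e V δ he hee hr3 hr2 hδ hV hEX
  rcases onlyScalar_or_exists_gauge_commute_sigma3 V with hIrr | ⟨g, hdiag⟩
  · -- irreducible datum
    exact HI F hF n K hnK e V he (hee.trans (min_le_left _ _)) (irr_of_onlyScalar F V hIrr)
  · -- diagonalisable datum: work at `V′ := g • V` and transport back along `g = (liftTransfTo g)↓`
    have hback : (varProblem3 F n K hnK.le).AtMostOneCriticalOrbit e (GaugeField.gaugeAct g V) → (varProblem3 F n K hnK.le).AtMostOneCriticalOrbit e V := by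
      intro hV'
      have h1 := atMostOneCriticalOrbit_gaugeAct F hnK.le (liftTransfTo F n K hnK.le fun x => (g x)⁻¹) e hV'
      rw [descTransf_liftTransfTo] at h1
      have hVV : GaugeField.gaugeAct (fun x => (g x)⁻¹) (GaugeField.gaugeAct g V) = V := by
        funext b
        show (g b.src)⁻¹ * (g b.src * V b * (g b.tgt)⁻¹) * ((g b.tgt)⁻¹)⁻¹ = V b
        rw [inv_inv, ← mul_assoc, ← mul_assoc, inv_mul_cancel, one_mul, mul_assoc, inv_mul_cancel, mul_one]
      rwa [hVV] at h1
    rcases parallelConstDiag_or_loopHol_central (GaugeField.gaugeAct g V) hdiag with hA | ⟨y₀, hcenB⟩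
    · -- case A: the abelian letter EX^{ab}′
      obtain ⟨W, hW, hreg, hmin⟩ := hEX g hdiag hA
      exact hback (HA F hF n K hnK e (GaugeField.gaugeAct g V) W he (hee.trans (min_le_right _ _)) hr3 hr2 hA hW hreg hmin)
    · -- case B: unconditional
      exact hback (atMostOneCriticalOrbit_of_loopHol_central F hnK (GaugeField.gaugeAct g V) y₀ hcenB hδ ((plaqSmall_gaugeAct_iff' δ g V).mpr hV) e)

end Master

end Summit.QuantumFields.YangMills.Theorems.FluctuationComparisonRegPrIntLS2BetaCriticalOrbitUniqueOfExabFree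

end
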